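import Summits.SmoothPoincare4.SmoothPoincare4.Theorems.ConvexBisectionAcyclicBisectionExistsCrossingNumberInvariance
import Summits.SmoothPoincare4.SmoothPoincare4.Theorems.ConvexBisectionAcyclicBisectionExistsCrossingNumberGenerators
import HarnessLib

/-!
# The crossing number of a page loop is a linear functional of its homology shadow
(wave 3, brick Z6-3 of the missing lemma `crossingNumber_eq_stdSymp` of node N1a
`node_M3c_shadow_pageDehnTwist` (Picard–Lefschetz on shadows) of stub `stub_modelsOnFibred_of_reach`
= NF4, line `modp-braid-orbits`, crux `ConvexBisection.AcyclicBisectionExists`, item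
stmt-SmoothPoincare4-10508; registered sub-goal `helper_crossingNumber_factors_shadow`)

Assembly of `…CrossingNumberInvariance.lean` (the crossing number `crossingNumber φ K` of a page
loop with an annulus chart `φ` of the page factors through `H₁(page g c; ℤ)` as a homomorphism)
and `…CrossingNumberGenerators.lean` (`H₁(page g c; ℤ) ≅ H₁(Base g; ℤ) ≅ ℤ^{2g}` through the
inclusion and the chain shadow, for every unit `c`; every vector is the shadow of a page loop):

* §1 **`crossingNumber_eq_sum_of_shadow_eq`**, `crossingNumber_eq_of_shadow_eq` — the crossing
  number of a page loop only depends on its homology SHADOW, additively;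
  `crossingNumber_eq_of_loop_family` — invariance along a continuous family of closed loops of the
  page with moving base points (descends to a homotopy of circle maps inside the page);
* §2 **`exists_crossingFunctional`** — there is a `ℤ`-linear functional `α` on `ℤ^{2g}` with
  `crossingNumber φ K = α (shadow g K hK)` for every loop `K` of the page; it is unique
  (`crossingFunctional_unique`) and kills the shadow of the core curve `a = φ (·, 0)` of the chart
  (`crossingFunctional_shadow_core`), as `stdSymp (shadow a) (shadow a) = 0` predicts;
* §3 **`crossingNumber_eq_stdSymp_of_basis`** — THE REDUCTION OF THE MISSING LEMMA TO A BASIS: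
  if page loops `L i` have shadows forming a basis `b` of `ℤ^{2g}` and
  `crossingNumber φ (L i) = stdSymp ℤ g A (b i)` for each `i`, then
  `crossingNumber φ K = stdSymp ℤ g A (shadow g K hK)` for EVERY page loop `K`
  (`crossingNumber_eq_stdSymp_of_chainVec`: the same over the chain basis `chainVec g`);
* §4 the registered form `helper_crossingNumber_factors_shadow`.

What then remains of `crossingNumber_eq_stdSymp` (V7-REPORT §3) is the EVALUATION on one family of
page loops realising a basis — the geometric half of convention (c) of `LefschetzBasePages.lean`
together with the orientation hypothesis `hφo` — i.e. `α = stdSymp ℤ g (shadow g a ha)`.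
Everything here is proved; no definitions, no named facts, no `sorry`.  References: B. Farb,
D. Margalit, *A primer on mapping class groups* (2012), §6.1 [FarbMargalit2012]; J. Milnor,
*Singular points of complex hypersurfaces* (1968), Thm. 9.1 [Milnor1968].
-/

noncomputable section

set_option linter.dupNamespace false

open scoped Manifold ContDiff Topology Real
open Set Function Metric Filter
open Literature.Topology.FourManifolds Literature.Topology.FourManifolds.LefschetzBase
  Literature.AlgebraicTopology.SingularHomology Literature.GroupTheory.CombinatorialGroupTheory.SignedHurwitz

namespace Summit.SmoothPoincare4.SmoothPoincare4.Theorems.AcyclicBisectionExists.ModpBraidOrbits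

variable {g : ℕ} {c : ℂ} {φ : ℝ × ℝ → Base g}
  {K K₁ K₂ : sphere (0 : EuclideanSpace ℝ (Fin 2)) 1 → Base g}

/-- A loop parametrising the core curve of a chart of the page lies in the page. [folklore] -/
theorem core_mem_page {a : sphere (0 : EuclideanSpace ℝ (Fin 2)) 1 → Base g}
    (hφa : ∀ u, φ (u, 0) = a (circlePt u)) (hφp : ∀ p, φ p ∈ page g c)
    (θ : sphere (0 : EuclideanSpace ℝ (Fin 2)) 1) : a θ ∈ page g c := by
  obtain ⟨t, rfl⟩ := circleParam_surjective θ
  show a (circlePt t) ∈ page g c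
  rw [← hφa]
  exact hφp _

/-- `core_mem_page` for a chart named differently from the section variable. [folklore] -/
theorem core_mem_page' {ψ : ℝ × ℝ → Base g} {a : sphere (0 : EuclideanSpace ℝ (Fin 2)) 1 → Base g}
    (hψa : ∀ u, ψ (u, 0) = a (circlePt u)) (hψp : ∀ p, ψ p ∈ page g c) :
    ∀ θ, a θ ∈ page g c := core_mem_page hψa hψp

/-! ## §1 The crossing number only depends on the shadow, additively -/

/-- **Additivity through shadows**: if `shadow K = Σᵢ nᵢ • shadow Lᵢ` for page loops `K`, `Lᵢ`,
then `crossingNumber φ K = Σᵢ nᵢ · crossingNumber φ Lᵢ`. [cite: FarbMargalit2012, §6.1] -/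
theorem crossingNumber_eq_sum_of_shadow_eq (hc : ‖c‖ = 1) (hφc : Continuous φ)
    (hφ1 : ∀ u r, φ (u + 1, r) = φ (u, r)) (hφp : ∀ p, φ p ∈ page g c)
    (hφi : InjOn φ (Ico (0 : ℝ) 1 ×ˢ Ioo (-1 : ℝ) 1)) (hK : Continuous K)
    (hKc : ∀ θ, K θ ∈ page g c) {ι : Type*} (s : Finset ι) (n : ι → ℤ)
    (L : ι → sphere (0 : EuclideanSpace ℝ (Fin 2)) 1 → Base g) (hL : ∀ i, Continuous (L i))
    (hLc : ∀ i θ, L i θ ∈ page g c)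
    (h : shadow g K hK = ∑ i ∈ s, n i • shadow g (L i) (hL i)) :
    crossingNumber φ K = ∑ i ∈ s, n i * crossingNumber φ (L i) :=
  crossingNumber_eq_sum_of_loopClass_eq hc hφc hφ1 hφp hφi hK hKc s n L hL hLc
    (loopClass_page_eq_sum_of_shadow_eq hc hK hKc s n L hL hLc h)

/-- **Page loops with the same shadow have the same crossing number.** [cite: FarbMargalit2012, §6.1] -/
theorem crossingNumber_eq_of_shadow_eq (hc : ‖c‖ = 1) (hφc : Continuous φ)
    (hφ1 : ∀ u r, φ (u + 1, r) = φ (u, r)) (hφp : ∀ p, φ p ∈ page g c)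
    (hφi : InjOn φ (Ico (0 : ℝ) 1 ×ˢ Ioo (-1 : ℝ) 1)) (hK₁ : Continuous K₁)
    (hK₁c : ∀ θ, K₁ θ ∈ page g c) (hK₂ : Continuous K₂) (hK₂c : ∀ θ, K₂ θ ∈ page g c)
    (h : shadow g K₁ hK₁ = shadow g K₂ hK₂) : crossingNumber φ K₁ = crossingNumber φ K₂ :=
  crossingNumber_eq_of_loopClass_eq hc hφc hφ1 hφp hφi hK₁ hK₁c hK₂ hK₂c
    (loopClass_page_eq_of_shadow_eq hc hK₁ hK₁c hK₂ hK₂c h)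

/-- **A continuous family of closed loops `G s : [0, 1] → page g c` (base points may move)
interpolating the unit-period loops of two page loops `K₁`, `K₂` forces
`crossingNumber φ K₁ = crossingNumber φ K₂`** (the family descends to a homotopy of circle maps
inside the page, `loopCircleMap_homotopic_of_family`; e.g. `G s t = ψ (t, s k)` moves the core of
another chart `ψ` to its level curve `height ψ = k`). [cite: FarbMargalit2012, §6.1] -/
theorem crossingNumber_eq_of_loop_family (hc : ‖c‖ = 1) (hφc : Continuous φ)
    (hφ1 : ∀ u r, φ (u + 1, r) = φ (u, r)) (hφp : ∀ p, φ p ∈ page g c)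
    (hφi : InjOn φ (Ico (0 : ℝ) 1 ×ˢ Ioo (-1 : ℝ) 1)) (hK₁ : Continuous K₁)
    (hK₁c : ∀ θ, K₁ θ ∈ page g c) (hK₂ : Continuous K₂) (hK₂c : ∀ θ, K₂ θ ∈ page g c)
    (G : ℝ → ℝ → Base g) (hG : ContinuousOn (uncurry G) (Icc (0 : ℝ) 1 ×ˢ Icc (0 : ℝ) 1))
    (hGc : ∀ s ∈ Icc (0 : ℝ) 1, ∀ t ∈ Icc (0 : ℝ) 1, G s t ∈ page g c)
    (hloop : ∀ s ∈ Icc (0 : ℝ) 1, G s 0 = G s 1)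
    (hG₁ : ∀ t ∈ Icc (0 : ℝ) 1, G 0 t = K₁ (circlePt t))
    (hG₂ : ∀ t ∈ Icc (0 : ℝ) 1, G 1 t = K₂ (circlePt t)) :
    crossingNumber φ K₁ = crossingNumber φ K₂ := by
  -- the unit-period loops in the page and their descent back to the co-restricted circle maps
  let γ : ∀ {L : sphere (0 : EuclideanSpace ℝ (Fin 2)) 1 → Base g} (hL : Continuous L)
      (hLc : ∀ θ, L θ ∈ page g c), C(unitInterval, ↥(page g c)) := fun {L} hL hLc =>
    ⟨fun t => ⟨L (circlePt t), hLc _⟩,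
      (hL.comp (continuous_circlePt.comp continuous_subtype_val)).subtype_mk _⟩
  have hγ : ∀ {L : sphere (0 : EuclideanSpace ℝ (Fin 2)) 1 → Base g} (hL : Continuous L)
      (hLc : ∀ θ, L θ ∈ page g c), γ hL hLc 0 = γ hL hLc 1 := fun {L} hL hLc => by
    apply Subtype.ext
    show L (circlePt (0 : ℝ)) = L (circlePt (1 : ℝ))
    rw [← circlePt_add_one 0, zero_add]
  have hdesc : ∀ {L : sphere (0 : EuclideanSpace ℝ (Fin 2)) 1 → Base g} (hL : Continuous L)
      (hLc : ∀ θ, L θ ∈ page g c), loopCircleMap (γ hL hLc) (hγ hL hLc) =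
        ⟨fun θ => (⟨L θ, hLc θ⟩ : ↥(page g c)), hL.subtype_mk hLc⟩ := fun {L} hL hLc => by
    ext u : 1
    obtain ⟨t, rfl⟩ := circleParam_surjective u
    rw [loopCircleMap_circleParam]
    rfl
  let G' : C(unitInterval × unitInterval, ↥(page g c)) :=
    ⟨fun p => ⟨G (p.1 : ℝ) (p.2 : ℝ), hGc _ p.1.2 _ p.2.2⟩, (hG.comp_continuous
      ((continuous_subtype_val.comp continuous_fst).prodMk (continuous_subtype_val.comp continuous_snd))
      fun p => ⟨p.1.2, p.2.2⟩).subtype_mk _⟩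
  have hfam := loopCircleMap_homotopic_of_family G' (fun s => Subtype.ext (hloop s s.2))
    (hγ hK₁ hK₁c) (hγ hK₂ hK₂c) (fun t => Subtype.ext (hG₁ t t.2)) (fun t => Subtype.ext (hG₂ t t.2))
  rw [hdesc hK₁ hK₁c, hdesc hK₂ hK₂c] at hfam
  exact crossingNumber_eq_of_homotopic hc hφc hφ1 hφp hφi hK₁ hK₁c hK₂ hK₂c hfam

/-- **The level curves of a chart are page loops**: for every level `k` there is a continuous
circle map `L` with `L (e^{2πit}) = ψ (t, k)`, and it lies in the page. [folklore] -/
theorem exists_levelLoop {ψ : ℝ × ℝ → Base g} (hψc : Continuous ψ)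
    (hψ1 : ∀ u r, ψ (u + 1, r) = ψ (u, r)) (hψp : ∀ p, ψ p ∈ page g c) (k : ℝ) :
    ∃ (L : sphere (0 : EuclideanSpace ℝ (Fin 2)) 1 → Base g) (_ : Continuous L),
      (∀ t : ℝ, L (circlePt t) = ψ (t, k)) ∧ ∀ θ, L θ ∈ page g c := by
  obtain ⟨L, hL, hLt⟩ := exists_coreCircle hψc hψ1 0 k 1 (Or.inl rfl)
  refine ⟨L, hL, fun t => by rw [hLt]; ring_nf, fun θ => ?_⟩
  obtain ⟨t, rfl⟩ := circleParam_surjective θ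
  show L (circlePt t) ∈ page g c
  rw [hLt]
  exact hψp _

/-- **Pushing the core of a chart `ψ` to one of its level curves does not change its crossing
number with any chart `φ` of the same page** (`G s t = ψ (t, s k)`). [cite: FarbMargalit2012, §6.1] -/
theorem crossingNumber_core_eq_level (hc : ‖c‖ = 1) (hφc : Continuous φ)
    (hφ1 : ∀ u r, φ (u + 1, r) = φ (u, r)) (hφp : ∀ p, φ p ∈ page g c)
    (hφi : InjOn φ (Ico (0 : ℝ) 1 ×ˢ Ioo (-1 : ℝ) 1))
    {b : sphere (0 : EuclideanSpace ℝ (Fin 2)) 1 → Base g} (hb : Continuous b) {ψ : ℝ × ℝ → Base g}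
    (hψc : Continuous ψ) (hψ1 : ∀ u r, ψ (u + 1, r) = ψ (u, r)) (hψa : ∀ u, ψ (u, 0) = b (circlePt u))
    (hψp : ∀ p, ψ p ∈ page g c) {k : ℝ} {L : sphere (0 : EuclideanSpace ℝ (Fin 2)) 1 → Base g}
    (hL : Continuous L) (hLk : ∀ t : ℝ, L (circlePt t) = ψ (t, k)) :
    crossingNumber φ b = crossingNumber φ L := by
  have hbc : ∀ θ, b θ ∈ page g c := core_mem_page' hψa hψp
  have hLc : ∀ θ, L θ ∈ page g c := fun θ => by
    obtain ⟨t, rfl⟩ := circleParam_surjective θ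
    show L (circlePt t) ∈ page g c
    rw [hLk]; exact hψp _
  refine crossingNumber_eq_of_loop_family hc hφc hφ1 hφp hφi hb hbc hL hLc (fun s t => ψ (t, s * k))
    ((hψc.comp (continuous_snd.prodMk (continuous_fst.mul continuous_const))).continuousOn)
    (fun s _ t _ => hψp _) (fun s _ => ?_) (fun t _ => ?_) (fun t _ => ?_)
  · show ψ (0, s * k) = ψ (1, s * k)
    rw [← hψ1 0, zero_add]
  · show ψ (t, 0 * k) = b (circlePt t)
    rw [zero_mul, hψa]
  · show ψ (t, 1 * k) = L (circlePt t)
    rw [one_mul, hLk]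

/-! ## §2 The crossing functional of a chart -/

/-- Expansion of a vector of `ℤ^{2g}` in the standard basis. [folklore] -/
theorem eq_sum_smul_single (v : Fin g ⊕ Fin g → ℤ) :
    v = ∑ s, v s • (Pi.single s (1 : ℤ) : Fin g ⊕ Fin g → ℤ) := by
  ext j
  simp [Finset.sum_apply, Pi.single_apply]

/-- **The crossing functional**: for an annulus chart `φ` of the page `page g c` there is a
`ℤ`-linear functional `α` on `ℤ^{2g}` with `crossingNumber φ K = α (shadow g K hK)` for every loop
`K` of that page. [cite: FarbMargalit2012, §6.1] -/
theorem exists_crossingFunctional (hc : ‖c‖ = 1) (hφc : Continuous φ)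
    (hφ1 : ∀ u r, φ (u + 1, r) = φ (u, r)) (hφp : ∀ p, φ p ∈ page g c)
    (hφi : InjOn φ (Ico (0 : ℝ) 1 ×ˢ Ioo (-1 : ℝ) 1)) :
    ∃ α : (Fin g ⊕ Fin g → ℤ) →ₗ[ℤ] ℤ, ∀ (K : sphere (0 : EuclideanSpace ℝ (Fin 2)) 1 → Base g)
      (hK : Continuous K), (∀ θ, K θ ∈ page g c) → crossingNumber φ K = α (shadow g K hK) := by
  have hex := fun s : Fin g ⊕ Fin g => exists_pageLoop_shadow_eq g hc (Pi.single s (1 : ℤ))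
  choose L hL hLc hLs using hex
  refine ⟨∑ s, crossingNumber φ (L s) • LinearMap.proj s, fun K hK hKc => ?_⟩
  have h : shadow g K hK = ∑ s, shadow g K hK s • shadow g (L s) (hL s) := by
    simp_rw [hLs]
    exact eq_sum_smul_single _
  rw [crossingNumber_eq_sum_of_shadow_eq hc hφc hφ1 hφp hφi hK hKc Finset.univ _ L hL hLc h,
    LinearMap.sum_apply]
  exact Finset.sum_congr rfl fun s _ => by
    rw [LinearMap.smul_apply, LinearMap.proj_apply, smul_eq_mul, mul_comm]

/-- **The crossing functional is unique** (shadows of page loops exhaust `ℤ^{2g}`). [folklore] -/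
theorem crossingFunctional_unique (hc : ‖c‖ = 1) {α α' : (Fin g ⊕ Fin g → ℤ) →ₗ[ℤ] ℤ}
    (hα : ∀ (K : sphere (0 : EuclideanSpace ℝ (Fin 2)) 1 → Base g) (hK : Continuous K),
      (∀ θ, K θ ∈ page g c) → crossingNumber φ K = α (shadow g K hK))
    (hα' : ∀ (K : sphere (0 : EuclideanSpace ℝ (Fin 2)) 1 → Base g) (hK : Continuous K),
      (∀ θ, K θ ∈ page g c) → crossingNumber φ K = α' (shadow g K hK)) : α = α' := by
  refine LinearMap.ext fun v => ?_
  obtain ⟨K, hK, hKc, hKv⟩ := exists_pageLoop_shadow_eq g hc v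
  rw [← hKv, ← hα K hK hKc, ← hα' K hK hKc]

/-- **The crossing functional kills the shadow of the core curve** `a = φ (·, 0)` of its chart
(as `stdSymp (shadow a) (shadow a) = 0` predicts). [cite: FarbMargalit2012, §6.1] -/
theorem crossingFunctional_shadow_core {a : sphere (0 : EuclideanSpace ℝ (Fin 2)) 1 → Base g}
    (ha : Continuous a) (hφ1 : ∀ u r, φ (u + 1, r) = φ (u, r))
    (hφa : ∀ u, φ (u, 0) = a (circlePt u)) (hφp : ∀ p, φ p ∈ page g c)
    (hφi : InjOn φ (Ico (0 : ℝ) 1 ×ˢ Ioo (-1 : ℝ) 1)) {α : (Fin g ⊕ Fin g → ℤ) →ₗ[ℤ] ℤ}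
    (hα : ∀ (K : sphere (0 : EuclideanSpace ℝ (Fin 2)) 1 → Base g) (hK : Continuous K),
      (∀ θ, K θ ∈ page g c) → crossingNumber φ K = α (shadow g K hK)) :
    α (shadow g a ha) = 0 := by
  rw [← hα a ha (core_mem_page hφa hφp), crossingNumber_core_eq_zero hφ1 hφa hφi]

/-! ## §3 Reduction of the missing lemma to its evaluation on a basis -/

/-- **Reduction to a basis**: if page loops `L i` have shadows forming a basis `b` of `ℤ^{2g}`
on which `crossingNumber φ (L i) = stdSymp ℤ g A (b i)`, then
`crossingNumber φ K = stdSymp ℤ g A (shadow g K hK)` for every loop `K` of the page.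
[cite: FarbMargalit2012, Prop. 6.3] -/
theorem crossingNumber_eq_stdSymp_of_basis (hc : ‖c‖ = 1) (hφc : Continuous φ)
    (hφ1 : ∀ u r, φ (u + 1, r) = φ (u, r)) (hφp : ∀ p, φ p ∈ page g c)
    (hφi : InjOn φ (Ico (0 : ℝ) 1 ×ˢ Ioo (-1 : ℝ) 1)) (A : Fin g ⊕ Fin g → ℤ)
    {ι : Type*} [Fintype ι] (b : Module.Basis ι ℤ (Fin g ⊕ Fin g → ℤ))
    (L : ι → sphere (0 : EuclideanSpace ℝ (Fin 2)) 1 → Base g) (hL : ∀ i, Continuous (L i))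
    (hLc : ∀ i θ, L i θ ∈ page g c) (hLs : ∀ i, shadow g (L i) (hL i) = b i)
    (hval : ∀ i, crossingNumber φ (L i) = stdSymp ℤ g A (b i))
    (hK : Continuous K) (hKc : ∀ θ, K θ ∈ page g c) :
    crossingNumber φ K = stdSymp ℤ g A (shadow g K hK) := by
  have hrepr : shadow g K hK = ∑ i, b.repr (shadow g K hK) i • shadow g (L i) (hL i) := by
    simp_rw [hLs]
    exact (b.sum_repr _).symm
  rw [crossingNumber_eq_sum_of_shadow_eq hc hφc hφ1 hφp hφi hK hKc Finset.univ _ L hL hLc hrepr]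
  conv_rhs => rw [hrepr]
  simp only [map_sum, map_zsmul, hLs, hval, smul_eq_mul]

/-- **Reduction to the chain basis**: if page loops `L i`, `i < 2g`, have the chain vectors
`chainVec g i` as shadows and `crossingNumber φ (L i) = stdSymp ℤ g A (chainVec g i)`, then
`crossingNumber φ K = stdSymp ℤ g A (shadow g K hK)` for every loop `K` of the page.
[cite: FarbMargalit2012, Prop. 6.3] -/
theorem crossingNumber_eq_stdSymp_of_chainVec (hc : ‖c‖ = 1) (hφc : Continuous φ)
    (hφ1 : ∀ u r, φ (u + 1, r) = φ (u, r)) (hφp : ∀ p, φ p ∈ page g c)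
    (hφi : InjOn φ (Ico (0 : ℝ) 1 ×ˢ Ioo (-1 : ℝ) 1)) (A : Fin g ⊕ Fin g → ℤ)
    (L : Fin (2 * g) → sphere (0 : EuclideanSpace ℝ (Fin 2)) 1 → Base g)
    (hL : ∀ i, Continuous (L i)) (hLc : ∀ i θ, L i θ ∈ page g c)
    (hLs : ∀ i, shadow g (L i) (hL i) = chainVec g i)
    (hval : ∀ i, crossingNumber φ (L i) = stdSymp ℤ g A (chainVec g i))
    (hK : Continuous K) (hKc : ∀ θ, K θ ∈ page g c) :
    crossingNumber φ K = stdSymp ℤ g A (shadow g K hK) := by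
  obtain ⟨b, hb⟩ := chainVec_basis g
  exact crossingNumber_eq_stdSymp_of_basis hc hφc hφ1 hφp hφi A b L hL hLc
    (fun i => (hLs i).trans (hb i).symm) (fun i => by rw [hval, hb]) hK hKc

/-- **The missing lemma, functional form**: `crossingNumber_eq_stdSymp` for the chart `φ` around
`a` holds as soon as its crossing functional is `stdSymp ℤ g (shadow g a ha)`, and conversely.
[cite: FarbMargalit2012, Prop. 6.3] -/
theorem crossingNumber_eq_stdSymp_iff_functional (hc : ‖c‖ = 1)
    {a : sphere (0 : EuclideanSpace ℝ (Fin 2)) 1 → Base g} (ha : Continuous a)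
    {α : (Fin g ⊕ Fin g → ℤ) →ₗ[ℤ] ℤ}
    (hα : ∀ (K : sphere (0 : EuclideanSpace ℝ (Fin 2)) 1 → Base g) (hK : Continuous K),
      (∀ θ, K θ ∈ page g c) → crossingNumber φ K = α (shadow g K hK)) :
    (∀ (K : sphere (0 : EuclideanSpace ℝ (Fin 2)) 1 → Base g) (hK : Continuous K),
      (∀ θ, K θ ∈ page g c) → crossingNumber φ K = stdSymp ℤ g (shadow g a ha) (shadow g K hK)) ↔
      α = stdSymp ℤ g (shadow g a ha) :=
  ⟨fun h => crossingFunctional_unique hc hα h, fun h K hK hKc => by rw [hα K hK hKc, h]⟩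

/-! ## §4 The registered form -/

/-- **Sub-goal `helper_crossingNumber_factors_shadow`** (Z6-3 of the missing lemma of node N1a of
NF4): for an annulus chart `φ` around the page curve `a` of the page `page g c` (continuous,
`1`-periodic, injective on `[0, 1) × (−1, 1)`, `φ (u, 0) = a (e^{2πiu})`) there is a `ℤ`-linear
functional `α` on `ℤ^{2g}`, vanishing on `shadow a`, such that the crossing number of EVERY loop
`K` of the page with the framed curve of the chart is `α (shadow K)`.  (Node N1a then reads
`shadow (τ ∘ K) = shadow K + sgn s · α (shadow K) · shadow a` by `helper_shadow_pageDehnTwist`, and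
its registered form is the identity `α = stdSymp ℤ g (shadow a)`.) [cite: FarbMargalit2012, Prop. 6.3] -/
theorem helper_crossingNumber_factors_shadow : ∀ (g : ℕ) (c : ℂ) (_hc : ‖c‖ = 1) (a : Metric.sphere (0 : EuclideanSpace ℝ (Fin 2)) 1 → Literature.Topology.FourManifolds.LefschetzBase.Base g) (ha : Continuous a) (φ : ℝ × ℝ → Literature.Topology.FourManifolds.LefschetzBase.Base g) (_hφc : Continuous φ) (_hφ1 : ∀ u r, φ (u + 1, r) = φ (u, r)) (_hφa : ∀ u, φ (u, 0) = a (Literature.Topology.FourManifolds.circlePt u)) (_hφp : ∀ p, φ p ∈ Literature.Topology.FourManifolds.LefschetzBase.page g c) (_hφi : Set.InjOn φ (Set.Ico (0 : ℝ) 1 ×ˢ Set.Ioo (-1 : ℝ) 1)), ∃ α : (Fin g ⊕ Fin g → ℤ) →ₗ[ℤ] ℤ, α (Literature.Topology.FourManifolds.LefschetzBase.shadow g a ha) = 0 ∧ ∀ (K : Metric.sphere (0 : EuclideanSpace ℝ (Fin 2)) 1 → Literature.Topology.FourManifolds.LefschetzBase.Base g) (hK : Continuous K), (∀ θ, K θ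 ∈ Literature.Topology.FourManifolds.LefschetzBase.page g c) → Summit.SmoothPoincare4.SmoothPoincare4.Theorems.AcyclicBisectionExists.ModpBraidOrbits.crossingNumber φ K = α (Literature.Topology.FourManifolds.LefschetzBase.shadow g K hK) := by
  intro g c hc a ha φ hφc hφ1 hφa hφp hφi
  obtain ⟨α, hα⟩ := exists_crossingFunctional hc hφc hφ1 hφp hφi
  exact ⟨α, crossingFunctional_shadow_core ha hφ1 hφa hφp hφi hα, hα⟩

end Summit.SmoothPoincare4.SmoothPoincare4.Theorems.AcyclicBisectionExists.ModpBraidOrbits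

end
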